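import Literature.Computability.AlgebraicComplexity.TransferGrowth
import Literature.Computability.AlgebraicComplexity.BlockSecondMoment
import HarnessLib

/-!
# The transfer sums for the Kumar–Saraf degree profile (Kumar–Saraf 2017, §8.3, §9)

Topic `Literature/Computability/AlgebraicComplexity`; Step 8 of the roadmap for
`kumarSaraf2017_imm_homDepthFour` (`HomogeneousDepthFour.lean`). The row degrees of a block of
`k = J + L` regular layers are ([KS, §8.3]) `deg 0 = n₁` (a large first degree, `n^η` in print),
`deg j = 2` for `1 ≤ j < J`, and `deg j = 1` for the last `L` layers. For this profile we
evaluate the transfer weights `wOf D deg`, `wOf0 D deg` (`BlockSecondMoment.lean`) and bound the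
run-weighted subset sums of `TransferRecursion.lean` / `TransferGrowth.lean`:

* `ksDeg n₁ J L`, `prod_ksDeg` (`∏ deg = n₁ 2^{J-1}`), `wOf_ksDeg_zero/mid/tail`.
* **`psi_same_D_le`** — for the `T₂` factor `D < 2`:
  `∑_A runWeight (wOf D deg) c true A ≤ 12 + κ` under the smallness conditions of
  `sum_runWeight_le_of_sameStart` made explicit for this profile.
* **`psi_diff_E_le`**, **`psi_same_E_le`** — for the `T₃` factor `E ≥ 2`, with
  `G = (E/2)^{J-1} E^L`: `Ψd ≤ (1 + 2cGk)^k` and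
  `Ψs ≤ (1 + 2cGk)^k (1 + (E/n₁)((E/2)^{J-1} J + G L))`.

These bounds are turned into the final constants `ρ₂`, `Θ₃` in `KSParams.lean` (`rho2_final`,
`theta3_final`) and used in `KSMain.lean`. Everything is proved; no named facts.

## References

* M. Kumar, S. Saraf, *On the power of homogeneous depth 4 arithmetic circuits*, SIAM J. Comput.
  46 (2017) 336–387 (arXiv:1404.1950): §8.3, Lemmas 9.2–9.4, Claim 9.7.
-/

noncomputable section

namespace Literature.Computability.AlgebraicComplexity.KumarSaraf

open Finset

/-- **The Kumar–Saraf degree profile** of a block: `n₁, 2, …, 2, 1, …, 1` (`J - 1` twos, `L` ones).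
[cite: KumarSaraf2017, §8.3] -/
def ksDeg (n₁ J L : ℕ) : Fin (J + L) → ℕ :=
  fun j => if (j : ℕ) = 0 then n₁ else if (j : ℕ) < J then 2 else 1

variable {n₁ J L : ℕ}

/-- The degrees are positive (`n₁ ≥ 1`). [folklore] -/
theorem one_le_ksDeg (hn : 1 ≤ n₁) (j : Fin (J + L)) : 1 ≤ ksDeg n₁ J L j := by
  unfold ksDeg; split_ifs <;> omega

/-- The degrees are at most `n₁` (for `n₁ ≥ 2`). [folklore] -/
theorem ksDeg_le (hn : 2 ≤ n₁) (j : Fin (J + L)) : ksDeg n₁ J L j ≤ n₁ := by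
  unfold ksDeg; split_ifs <;> omega

/-- **`∏ deg = n₁ · 2^{J-1}`** (`J ≥ 1`). [cite: KumarSaraf2017, §8.2] -/
theorem prod_ksDeg (hJ : 1 ≤ J) : ∏ j, ksDeg n₁ J L j = n₁ * 2 ^ (J - 1) := by
  -- split the product over `Fin (J+L)` as a product over `range (J+L)`
  have h : ∏ j : Fin (J + L), ksDeg n₁ J L j =
      ∏ i ∈ range (J + L), (if i = 0 then n₁ else if i < J then 2 else 1) := by
    rw [← Fin.prod_univ_eq_prod_range]; rfl
  rw [h]
  have hsplit : range (J + L) = {0} ∪ (Ico 1 J ∪ Ico J (J + L)) := by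
    ext i; simp only [mem_range, mem_union, mem_singleton, mem_Ico]; omega
  rw [hsplit, prod_union, prod_union, prod_singleton, if_pos rfl]
  · have h1 : ∏ i ∈ Ico 1 J, (if i = 0 then n₁ else if i < J then 2 else 1) = 2 ^ (J - 1) := by
      have : ∏ i ∈ Ico 1 J, (if i = 0 then n₁ else if i < J then 2 else 1) = ∏ _i ∈ Ico 1 J, 2 :=
        prod_congr rfl fun i hi => by
          rw [mem_Ico] at hi; rw [if_neg (by omega), if_pos hi.2]
      rw [this, prod_const, Nat.card_Ico]
    have h2 : ∏ i ∈ Ico J (J + L), (if i = 0 then n₁ else if i < J then 2 else 1) = 1 :=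
      prod_eq_one fun i hi => by rw [mem_Ico] at hi; rw [if_neg (by omega), if_neg (by omega)]
    rw [h1, h2, mul_one]
  · rw [disjoint_left]; intro i h1 h2; rw [mem_Ico] at h1 h2; omega
  · rw [disjoint_left]; intro i h1 h2
    rw [mem_singleton] at h1; rw [mem_union, mem_Ico, mem_Ico] at h2; omega

/-- The first transfer weight: `D / n₁`. [folklore] -/
theorem wOf_ksDeg_zero (D : ℝ) (hk : 0 < J + L) : wOf D (ksDeg n₁ J L) 0 = D / n₁ := by
  unfold wOf ksDeg; rw [dif_pos hk]; simp

/-- The middle transfer weights: `D / 2`. [folklore] -/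
theorem wOf_ksDeg_mid (D : ℝ) {j : ℕ} (h1 : 1 ≤ j) (h2 : j < J) : wOf D (ksDeg n₁ J L) j = D / 2 := by
  have hj : j < J + L := by omega
  have h0 : j ≠ 0 := by omega
  simp only [wOf, ksDeg, dif_pos hj, if_neg h0, if_pos h2]
  norm_num

/-- The tail transfer weights: `D`. [folklore] -/
theorem wOf_ksDeg_tail (D : ℝ) {j : ℕ} (h1 : J ≤ j) (h2 : j < J + L) (hJ : 1 ≤ J) :
    wOf D (ksDeg n₁ J L) j = D := by
  have h0 : j ≠ 0 := by omega
  have hJ' : ¬ j < J := by omega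
  simp only [wOf, ksDeg, dif_pos h2, if_neg h0, if_neg hJ']
  norm_num

/-- Beyond the block the weights vanish. [folklore] -/
theorem wOf_ksDeg_of_le (D : ℝ) {j : ℕ} (h : J + L ≤ j) : wOf D (ksDeg n₁ J L) j = 0 := by
  unfold wOf; rw [dif_neg (by omega)]

/-- **The `T₂` transfer sum for the KS profile** ([KS, Lemmas 9.2–9.3]): with `δ = 1 - D/2 > 0`,
`∑_A runWeight (wOf D deg) c true A ≤ 12 + κ` under the listed smallness conditions.
[cite: KumarSaraf2017, Lemma 9.2] -/
theorem psi_same_D_le {D c κ : ℝ} (hD0 : 0 ≤ D) (hD2 : D < 2) (hc : 0 ≤ c) (hJ : 1 ≤ J)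
    (h0 : D / n₁ ≤ 1 - D / 2) (hcJ : 2 * c * J ≤ 1 - D / 2)
    (hcL : c * L * 2 ^ (L + 2) ≤ 1 / 2) (hcδ : 2 ^ (L + 3) * c ≤ 1 - D / 2)
    (hκ : 2 ^ (L + 2) * (D / n₁) * (D / 2) ^ (J - 1) ≤ κ) :
    ∑ A ∈ (range (J + L)).powerset, runWeight (wOf D (ksDeg n₁ J L)) c true A ≤ 12 + κ := by
  have hw : ∀ j, 0 ≤ wOf D (ksDeg n₁ J L) j := wOf_nonneg hD0 _
  refine sum_runWeight_le_of_sameStart hw hc (δ := 1 - D / 2) (by linarith) (by linarith) hJ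
    ?_ ?_ ?_ hcJ hcL hcδ ?_
  · rw [wOf_ksDeg_zero D (by omega)]; exact h0
  · intro j h1 h2; rw [wOf_ksDeg_mid D h1 h2]; linarith
  · intro j h1 h2; rw [wOf_ksDeg_tail D h1 h2 hJ]; linarith
  · rw [wOf_ksDeg_zero D (by omega)]
    have : (1 - (1 - D / 2)) = D / 2 := by ring
    rw [this]; exact hκ

/-- The growth constant of the KS profile for a factor `E ≥ 2`: `G = (E/2)^{J-1} E^L`, the weight of
the interval `[1, k)`. [cite: KumarSaraf2017, Claim 9.7] -/
theorem prod_Ico_one_wOf (E : ℝ) (hJ : 1 ≤ J) :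
    ∏ l ∈ Ico 1 (J + L), wOf E (ksDeg n₁ J L) l = (E / 2) ^ (J - 1) * E ^ L := by
  have hsplit : Ico 1 (J + L) = Ico 1 J ∪ Ico J (J + L) := by
    ext i; simp only [mem_union, mem_Ico]; omega
  rw [hsplit, prod_union]
  · have hA : ∏ l ∈ Ico 1 J, wOf E (ksDeg n₁ J L) l = ∏ _l ∈ Ico 1 J, E / 2 :=
      prod_congr rfl fun i hi => by rw [mem_Ico] at hi; exact wOf_ksDeg_mid E hi.1 hi.2
    have hB : ∏ l ∈ Ico J (J + L), wOf E (ksDeg n₁ J L) l = ∏ _l ∈ Ico J (J + L), E :=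
      prod_congr rfl fun i hi => by rw [mem_Ico] at hi; exact wOf_ksDeg_tail E hi.1 hi.2 hJ
    rw [hA, hB, prod_const, prod_const, Nat.card_Ico, Nat.card_Ico, Nat.add_sub_cancel_left]
  · rw [disjoint_left]; intro i h1 h2; rw [mem_Ico] at h1 h2; omega

/-- Interval products of the weights (from layer `1` on) are at most `G` when `E ≥ 2`. [folklore] -/
theorem prod_Ico_wOf_le {E : ℝ} (hE : 2 ≤ E) (hJ : 1 ≤ J) {i j : ℕ} (hi : 1 ≤ i) (hj : j ≤ J + L) :
    ∏ l ∈ Ico i j, wOf E (ksDeg n₁ J L) l ≤ (E / 2) ^ (J - 1) * E ^ L := by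
  have hE0 : 0 ≤ E := by linarith
  rw [← prod_Ico_one_wOf E hJ]
  refine Finset.prod_le_prod_of_subset_of_one_le (fun l hl => ?_) (fun l _ => wOf_nonneg hE0 _ l) (fun l hl _ => ?_)
  · rw [mem_Ico] at hl ⊢; omega
  · rw [mem_Ico] at hl
    by_cases hlJ : l < J
    · rw [wOf_ksDeg_mid E hl.1 hlJ]; linarith
    · rw [wOf_ksDeg_tail E (not_lt.1 hlJ) hl.2 hJ]; linarith

/-- **The `T₃` different-start transfer sum for the KS profile** ([KS, Claim 9.7]):
`Ψd ≤ (1 + 2cGk)^k`, `G = (E/2)^{J-1} E^L`, when `E ≥ 2` and `cGk ≤ 1/2`. [cite: KumarSaraf2017, Claim 9.7] -/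
theorem psi_diff_E_le {E c : ℝ} (hE : 2 ≤ E) (hc : 0 ≤ c) (hJ : 1 ≤ J)
    (hx : c * ((E / 2) ^ (J - 1) * E ^ L) * (J + L : ℕ) ≤ 1 / 2) :
    ∑ A ∈ (range (J + L)).powerset, runWeight (wOf0 E (ksDeg n₁ J L)) c false A ≤
      (1 + 2 * (c * ((E / 2) ^ (J - 1) * E ^ L) * (J + L : ℕ))) ^ (J + L) := by
  have hE0 : 0 ≤ E := by linarith
  have hw : ∀ j, 0 ≤ wOf0 E (ksDeg n₁ J L) j := wOf0_nonneg hE0 _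
  refine tSeq_le_growth_diffStart hw hc (G := (E / 2) ^ (J - 1) * E ^ L) ?_ hx
  intro i j hij hjk
  by_cases hi0 : i = 0
  · subst hi0
    rcases Nat.eq_zero_or_pos j with rfl | hjpos
    · rw [Ico_self, prod_empty]
      have h1 : (1 : ℝ) ≤ (E / 2) ^ (J - 1) := one_le_pow₀ (by linarith)
      have h2 : (1 : ℝ) ≤ E ^ L := one_le_pow₀ (by linarith)
      nlinarith
    · -- the factor at `0` vanishes
      rw [prod_eq_zero (i := 0) (by rw [mem_Ico]; omega) (wOf0_zero E _)]
      positivity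
  · calc ∏ l ∈ Ico i j, wOf0 E (ksDeg n₁ J L) l = ∏ l ∈ Ico i j, wOf E (ksDeg n₁ J L) l :=
          prod_congr rfl fun l hl => by rw [mem_Ico] at hl; exact wOf0_of_ne_zero E _ (by omega)
      _ ≤ _ := prod_Ico_wOf_le hE hJ (Nat.pos_of_ne_zero hi0) hjk

/-- The uncharged initial run of the KS profile: `∏_{l<j} w_l ≤ (E/n₁)(E/2)^{J-1}` for
`1 ≤ j ≤ J`, and `≤ (E/n₁) G` for `J < j ≤ k` (`E ≥ 2`). [cite: KumarSaraf2017, Lemma 9.3] -/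
theorem prod_range_wOf_le {E : ℝ} (hE : 2 ≤ E) (hJ : 1 ≤ J) (hn : 0 < n₁) {j : ℕ} (h1 : 1 ≤ j)
    (h2 : j ≤ J + L) :
    ∏ l ∈ range j, wOf E (ksDeg n₁ J L) l ≤
      (E / n₁) * (if j ≤ J then (E / 2) ^ (J - 1) else (E / 2) ^ (J - 1) * E ^ L) := by
  have hE0 : 0 ≤ E := by linarith
  rw [range_eq_Ico, prod_eq_prod_Ico_succ_bot (by omega : 0 < j), wOf_ksDeg_zero E (by omega)]
  refine mul_le_mul_of_nonneg_left ?_ (by positivity)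
  split_ifs with hjJ
  · -- inside the middle part
    calc ∏ l ∈ Ico (0 + 1) j, wOf E (ksDeg n₁ J L) l ≤ ∏ l ∈ Ico 1 J, wOf E (ksDeg n₁ J L) l := by
          refine Finset.prod_le_prod_of_subset_of_one_le (fun l hl => ?_) (fun l _ => wOf_nonneg hE0 _ l)
            (fun l hl _ => ?_)
          · rw [mem_Ico] at hl ⊢; omega
          · rw [mem_Ico] at hl; rw [wOf_ksDeg_mid E hl.1 hl.2]; linarith
      _ = (E / 2) ^ (J - 1) := by
          have hA : ∏ l ∈ Ico 1 J, wOf E (ksDeg n₁ J L) l = ∏ _l ∈ Ico 1 J, E / 2 :=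
            prod_congr rfl fun i hi => by rw [mem_Ico] at hi; exact wOf_ksDeg_mid E hi.1 hi.2
          rw [hA, prod_const, Nat.card_Ico]
  · exact prod_Ico_wOf_le hE hJ le_rfl h2

/-- **The `T₃` same-start transfer sum for the KS profile** ([KS, §9.3]):
`Ψs ≤ (1 + 2cGk)^k (1 + (E/n₁)((E/2)^{J-1} J + G L))`. [cite: KumarSaraf2017, Claim 9.7] -/
theorem psi_same_E_le {E c : ℝ} (hE : 2 ≤ E) (hEn : E ≤ n₁) (hc : 0 ≤ c) (hJ : 1 ≤ J) (hn : 0 < n₁)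
    (hx : c * ((E / 2) ^ (J - 1) * E ^ L) * (J + L : ℕ) ≤ 1 / 2) :
    ∑ A ∈ (range (J + L)).powerset, runWeight (wOf E (ksDeg n₁ J L)) c true A ≤
      (1 + 2 * (c * ((E / 2) ^ (J - 1) * E ^ L) * (J + L : ℕ))) ^ (J + L) *
        (1 + (E / n₁) * ((E / 2) ^ (J - 1) * J + (E / 2) ^ (J - 1) * E ^ L * L)) := by
  have hE0 : 0 ≤ E := by linarith
  have hw : ∀ j, 0 ≤ wOf E (ksDeg n₁ J L) j := wOf_nonneg hE0 _
  have hG : ∀ i j, i ≤ j → j ≤ J + L → ∏ l ∈ Ico i j, wOf E (ksDeg n₁ J L) l ≤ (E / 2) ^ (J - 1) * E ^ L := by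
    intro i j hij hjk
    by_cases hi0 : i = 0
    · subst hi0
      rcases Nat.eq_zero_or_pos j with rfl | hjpos
      · rw [Ico_self, prod_empty]
        have h1 : (1 : ℝ) ≤ (E / 2) ^ (J - 1) := one_le_pow₀ (by linarith)
        have h2 : (1 : ℝ) ≤ E ^ L := one_le_pow₀ (by linarith)
        nlinarith
      · rw [← range_eq_Ico]
        refine (prod_range_wOf_le hE hJ hn hjpos hjk).trans ?_
        have hdiv : E / n₁ ≤ 1 := (div_le_one (by exact_mod_cast hn)).2 hEn
        have hG0 : 0 ≤ (E / 2) ^ (J - 1) * E ^ L := by positivity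
        have h1 : (E / 2) ^ (J - 1) ≤ (E / 2) ^ (J - 1) * E ^ L :=
          le_mul_of_one_le_right (by positivity) (one_le_pow₀ (by linarith))
        split_ifs
        · calc E / n₁ * (E / 2) ^ (J - 1) ≤ 1 * (E / 2) ^ (J - 1) :=
              mul_le_mul_of_nonneg_right hdiv (by positivity)
            _ ≤ _ := by rw [one_mul]; exact h1
        · calc E / n₁ * ((E / 2) ^ (J - 1) * E ^ L) ≤ 1 * ((E / 2) ^ (J - 1) * E ^ L) :=
              mul_le_mul_of_nonneg_right hdiv hG0
            _ = _ := one_mul _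
    · exact prod_Ico_wOf_le hE hJ (Nat.pos_of_ne_zero hi0) hjk
  refine (tSeq_le_growth_sameStart hw hc hG hx).trans ?_
  refine mul_le_mul_of_nonneg_left ?_ (pow_nonneg (by positivity) _)
  -- the initial-run sum
  have hsplit : Ico 1 (J + L + 1) = Ico 1 (J + 1) ∪ Ico (J + 1) (J + L + 1) := by
    ext i; simp only [mem_union, mem_Ico]; omega
  rw [hsplit, sum_union]
  · have h1 : ∑ j ∈ Ico 1 (J + 1), ∏ l ∈ range j, wOf E (ksDeg n₁ J L) l ≤ (E / n₁) * (E / 2) ^ (J - 1) * J := by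
      calc _ ≤ ∑ _j ∈ Ico 1 (J + 1), (E / n₁) * (E / 2) ^ (J - 1) := by
            refine sum_le_sum fun j hj => ?_
            rw [mem_Ico] at hj
            have := prod_range_wOf_le (L := L) hE hJ hn hj.1 (by omega)
            rw [if_pos (by omega)] at this; exact this
        _ = _ := by rw [sum_const, Nat.card_Ico, Nat.add_sub_cancel, nsmul_eq_mul]; ring
    have h2 : ∑ j ∈ Ico (J + 1) (J + L + 1), ∏ l ∈ range j, wOf E (ksDeg n₁ J L) l ≤
        (E / n₁) * ((E / 2) ^ (J - 1) * E ^ L) * L := by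
      calc _ ≤ ∑ _j ∈ Ico (J + 1) (J + L + 1), (E / n₁) * ((E / 2) ^ (J - 1) * E ^ L) := by
            refine sum_le_sum fun j hj => ?_
            rw [mem_Ico] at hj
            have := prod_range_wOf_le (L := L) hE hJ hn (by omega) (by omega : j ≤ J + L)
            rw [if_neg (by omega)] at this; exact this
        _ = _ := by
            rw [sum_const, Nat.card_Ico, show J + L + 1 - (J + 1) = L by omega, nsmul_eq_mul]; ring
    nlinarith [h1, h2]
  · rw [disjoint_left]; intro i h1 h2; rw [mem_Ico] at h1 h2; omega

end Literature.Computability.AlgebraicComplexity.KumarSaraf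

end
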